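import Literature.Combinatorics.Optimization.ShellLawPinning
import HarnessLib

/-!
# Pinning one full edge, and the first two moments of the number of `HH` edges inside a cut against a block statistic

Continuation of `ShellLawPinning.lean` (two full edges pinned). Fix a perfect matching (`π` its partner
involution), a `π`-stable ground set `S`, a block `H`. For a cut `U` write `n_A(U)` for the number of EDGES of
type `HH` (both endpoints in `H`) lying inside `U` — spelled here without a new definition as
`#{v ∈ reps(vAA_π(S,H)) : v ∈ U ∧ πv ∈ U}`. The cell's tilted masks outside the crossing plane (the "γ-direction",
prover MEMO-25 §2(c)/(d), MEMO-28 §3c) are `ψ(|U∩H|)·(γ·n_A(U) + L)²`; expanding the square needs the shell sums of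
`ψ(|U∩H|)·n_A(U)` and `ψ(|U∩H|)·n_A(U)(n_A(U)−1)`. Pinning one (resp. two) `HH` edges reduces them EXACTLY to
untilted shell sums of SHIFTED profiles on the ground sets with one (resp. two) `HH` edges deleted:

* §1 `card_pin_one_eq_shellCount` — `#{U ∈ Shell_S(t+2,c) : e_v ⊆ U, |U∩H| = x} = Sh_{S∖e_v}(t,c; x − |e_v∩H|)`;
  **`sum_shell_pin_one_eq`** — `Σ_{U ∈ Shell_S(t+2,c), e_v ⊆ U} ψ(|U∩H|) = Σ_{U′ ∈ Shell_{S∖e_v}(t,c)} ψ(|U′∩H| + |e_v∩H|)`;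
  **`shellAvg_pin_one_eq`** — the tilted average is `((t+2−c)/|S|)·` the untilted average of the shifted profile
  (`card_shellIn_sdiff_pair_ratio`: the probability that a given edge is full is `s/N`, LINEAR in the level).
* §2 `hhCount_eq_sum_ite` (`n_A(U)` as a sum of indicators over the representatives of the `HH` edges),
  **`sum_shell_mul_hhCount_eq`** — FIRST MOMENT:
  `Σ_{U ∈ Shell_S(t+2,c)} ψ(|U∩H|)·n_A(U) = Σ_{v ∈ reps(vAA)} Σ_{U′ ∈ Shell_{S∖e_v}(t,c)} ψ(|U′∩H| + 2)`.
* §3 `hhCount_mul_pred_eq_sum` (`n_A(n_A − 1)` = ordered pairs of distinct `HH` edges inside `U`),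
  **`sum_shell_mul_hhCount_mul_pred_eq`** — SECOND FACTORIAL MOMENT:
  `Σ_{U ∈ Shell_S(t+4,c)} ψ(|U∩H|)·n_A(U)(n_A(U)−1) = Σ_{v ≠ w ∈ reps(vAA)} Σ_{U″ ∈ Shell_{S∖e_v∖e_w}(t,c)} ψ(|U″∩H| + 4)`.

All PROVED, 0 sorry, no definitions, no named facts; bookkeeping on Rothvoß's slack-matrix combinatorics. Cell
pnp-psdrank (prover g25, MEMO-28 §3c recommended line (L-b), first brick: the inputs of the γ-direction pinning
reduction). Together with §2 of `ShellLawPinning` (pinning ratios `s/N`, `s(s−1)/(N(N−1))`) the level profiles of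
`ψ·n_A` and `ψ·n_A(n_A−1)` are (polynomial of degree ≤ 2 in `c`) × (block-statistic profiles on deleted ground sets).

## References
* [Rothvoss2017] T. Rothvoß, J. ACM 64 (2017), §2 (PDF pp. 5–6): cuts, perfect matchings, the three edge types.
* [GodsilMeagher2015] C. Godsil, K. Meagher, *Erdős–Ko–Rado Theorems: Algebraic Approaches*, §15.2 (perfect
  matchings as fixed-point-free involutions; edge representatives).
-/

noncomputable section

open Finset

namespace Literature.Combinatorics.Optimization

namespace ShellStep

variable {n : ℕ} {π : Fin n → Fin n}

section Pin

variable (hπ : ∀ v, π (π v) = v) (hπ' : ∀ v, π v ≠ v)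
include hπ hπ'

/-! ### §1 One full edge pinned -/

/-- **The pinned block-statistic count, one edge**: `#{U ∈ Shell_S(t+2,c) : v,πv ∈ U, |U∩H| = x} = Sh_{S∖e_v}(t,c; x − |e_v∩H|)`.
[cite: Rothvoss2017, §2 (PDF p. 6)] -/
theorem card_pin_one_eq_shellCount {S : Finset (Fin n)} (hS : ∀ u ∈ S, π u ∈ S) (H : Finset (Fin n))
    {v : Fin n} (hv : v ∈ S) (t c : ℕ) (x : ℤ) :
    (((shellIn π S (t + 2) c).filter fun U => v ∈ U ∧ π v ∈ U ∧ ((U ∩ H).card : ℤ) = x).card : ℝ) =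
      shellCount π (S \ {v, π v}) H t c (x - (({v, π v} ∩ H).card : ℤ)) := by
  have h := card_shellIn_full_filter hπ hπ' hS hv t c
    (fun W : Finset (Fin n) => ((W ∩ H).card : ℤ) = x - (({v, π v} ∩ H).card : ℤ))
  have e : ((shellIn π S (t + 2) c).filter fun U => v ∈ U ∧ π v ∈ U ∧ ((U ∩ H).card : ℤ) = x) =
      ((shellIn π S (t + 2) c).filter fun U => v ∈ U ∧ π v ∈ U ∧
        (((U \ {v, π v}) ∩ H).card : ℤ) = x - (({v, π v} ∩ H).card : ℤ)) := by
    refine filter_congr fun U _ => ?_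
    constructor
    · rintro ⟨hvU, hπvU, hx⟩
      exact ⟨hvU, hπvU, by rw [card_inter_sdiff_pair hvU hπvU H, hx]⟩
    · rintro ⟨hvU, hπvU, hx⟩
      refine ⟨hvU, hπvU, ?_⟩
      rw [card_inter_sdiff_pair hvU hπvU H] at hx
      omega
  rw [shellCount, ← h, e]

/-- **Pinned shell sum, one edge**: `Σ_{U ∈ Shell_S(t+2,c), e_v ⊆ U} ψ(|U∩H|) = Σ_{U′ ∈ Shell_{S∖e_v}(t,c)} ψ(|U′∩H| + |e_v∩H|)`.
[cite: Rothvoss2017, §2 (PDF p. 6)] -/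
theorem sum_shell_pin_one_eq {S : Finset (Fin n)} (hS : ∀ u ∈ S, π u ∈ S) (H : Finset (Fin n))
    {v : Fin n} (hv : v ∈ S) (t c : ℕ) (ψ : ℤ → ℝ) :
    ∑ U ∈ (shellIn π S (t + 2) c).filter (fun U => v ∈ U ∧ π v ∈ U), ψ ((U ∩ H).card : ℤ) =
      ∑ U' ∈ shellIn π (S \ {v, π v}) t c, ψ (((U' ∩ H).card : ℤ) + (({v, π v} ∩ H).card : ℤ)) := by
  set σ : ℤ := (({v, π v} ∩ H).card : ℤ) with hσ
  set Win : Finset ℤ := Icc (0 : ℤ) ((t : ℤ) + 2) with hWin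
  have hmapsL : ∀ U ∈ (shellIn π S (t + 2) c).filter (fun U => v ∈ U ∧ π v ∈ U), ((U ∩ H).card : ℤ) ∈ Win := by
    intro U hU
    have hU' := (mem_filter.1 hU).1
    rw [hWin, mem_Icc]
    refine ⟨by positivity, ?_⟩
    have h1 : (U ∩ H).card ≤ U.card := card_le_card inter_subset_left
    have h2 : U.card = t + 2 := (mem_shellIn.1 hU').2.1
    have : ((U ∩ H).card : ℤ) ≤ ((t + 2 : ℕ) : ℤ) := by exact_mod_cast h2 ▸ h1
    push_cast at this; exact this
  have hmapsR : ∀ U' ∈ shellIn π (S \ {v, π v}) t c, ((U' ∩ H).card : ℤ) + σ ∈ Win := by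
    intro U' hU'
    rw [hWin, mem_Icc]
    refine ⟨by positivity, ?_⟩
    have h1 : (U' ∩ H).card ≤ U'.card := card_le_card inter_subset_left
    have h2 : U'.card = t := (mem_shellIn.1 hU').2.1
    have h3 : ({v, π v} ∩ H).card ≤ 2 := (card_le_card inter_subset_left).trans (card_insert_le _ _)
    have : ((U' ∩ H).card : ℤ) ≤ t := by exact_mod_cast h2 ▸ h1
    have h3' : (({v, π v} ∩ H).card : ℤ) ≤ 2 := by exact_mod_cast h3
    rw [hσ]; linarith
  rw [← sum_fiberwise_of_maps_to hmapsL, ← sum_fiberwise_of_maps_to hmapsR]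
  refine sum_congr rfl fun x _ => ?_
  have hL : ∑ U ∈ ((shellIn π S (t + 2) c).filter (fun U => v ∈ U ∧ π v ∈ U)).filter
        (fun U => ((U ∩ H).card : ℤ) = x), ψ ((U ∩ H).card : ℤ) =
      ψ x * (((shellIn π S (t + 2) c).filter fun U => v ∈ U ∧ π v ∈ U ∧ ((U ∩ H).card : ℤ) = x).card : ℝ) := by
    rw [filter_filter]
    have e : ((shellIn π S (t + 2) c).filter fun U => (v ∈ U ∧ π v ∈ U) ∧ ((U ∩ H).card : ℤ) = x) =
        ((shellIn π S (t + 2) c).filter fun U => v ∈ U ∧ π v ∈ U ∧ ((U ∩ H).card : ℤ) = x) :=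
      filter_congr fun U _ => by tauto
    rw [e, mul_comm, ← nsmul_eq_mul, ← sum_const]
    refine sum_congr rfl fun U hU => ?_
    rw [(mem_filter.1 hU).2.2.2]
  have hR : ∑ U' ∈ (shellIn π (S \ {v, π v}) t c).filter (fun U' => ((U' ∩ H).card : ℤ) + σ = x),
        ψ (((U' ∩ H).card : ℤ) + σ) = ψ x * shellCount π (S \ {v, π v}) H t c (x - σ) := by
    rw [shellCount]
    have e : ((shellIn π (S \ {v, π v}) t c).filter fun U' => ((U' ∩ H).card : ℤ) + σ = x) =
        ((shellIn π (S \ {v, π v}) t c).filter fun U' => ((U' ∩ H).card : ℤ) = x - σ) :=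
      filter_congr fun U _ => by omega
    rw [e, mul_comm, ← nsmul_eq_mul, ← sum_const]
    refine sum_congr rfl fun U hU => ?_
    rw [(mem_filter.1 hU).2, sub_add_cancel]
  rw [hL, hR, card_pin_one_eq_shellCount hπ hπ' hS H hv t c x, hσ]

/-- **Pinned shell average, one edge**: for `Shell_S(t+2,c) ≠ ∅`,
`(Σ_{U ∈ Shell_S(t+2,c), e_v ⊆ U} ψ(|U∩H|)) / |Shell_S(t+2,c)| = ((t+2−c)/|S|)·(Σ_{U′ ∈ Shell_{S∖e_v}(t,c)} ψ(|U′∩H| + |e_v∩H|)) / |Shell_{S∖e_v}(t,c)|`: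
the probability that a given edge is full is `s/N` (`s = (t+2−c)/2`, `N = |S|/2`), LINEAR in the level `c`.
[cite: Rothvoss2017, §2 (PDF p. 6)] [cite: GodsilMeagher2015, §15.2] -/
theorem shellAvg_pin_one_eq {S : Finset (Fin n)} (hS : ∀ u ∈ S, π u ∈ S) (H : Finset (Fin n))
    {v : Fin n} (hv : v ∈ S) (t c : ℕ) (ψ : ℤ → ℝ) (hne : (shellIn π S (t + 2) c).Nonempty) :
    (∑ U ∈ (shellIn π S (t + 2) c).filter (fun U => v ∈ U ∧ π v ∈ U), ψ ((U ∩ H).card : ℤ)) /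
        ((shellIn π S (t + 2) c).card : ℝ) =
      (((t : ℝ) + 2 - c) / (S.card : ℝ)) *
        ((∑ U' ∈ shellIn π (S \ {v, π v}) t c, ψ (((U' ∩ H).card : ℤ) + (({v, π v} ∩ H).card : ℤ))) /
          ((shellIn π (S \ {v, π v}) t c).card : ℝ)) := by
  rw [sum_shell_pin_one_eq hπ hπ' hS H hv t c ψ]
  have hr := card_shellIn_sdiff_pair_ratio hπ hπ' hS hv t c
  have hS2 : t + 2 + c ≤ S.card := by obtain ⟨U, hU⟩ := hne; exact add_le_of_mem_shellIn hπ hS hU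
  have hSpos : (0 : ℝ) < S.card := by
    have : 2 ≤ S.card := by omega
    have : (2 : ℝ) ≤ S.card := by exact_mod_cast this
    linarith
  have hA : (0 : ℝ) < (shellIn π S (t + 2) c).card := by exact_mod_cast hne.card_pos
  by_cases hB : shellIn π (S \ {v, π v}) t c = ∅
  · simp [hB]
  have hBpos : (0 : ℝ) < (shellIn π (S \ {v, π v}) t c).card := by
    exact_mod_cast (nonempty_iff_ne_empty.2 hB).card_pos
  rw [div_mul_div_comm, div_eq_div_iff hA.ne' (mul_ne_zero hSpos.ne' hBpos.ne')]
  linear_combination (∑ U' ∈ shellIn π (S \ {v, π v}) t c,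
    ψ (((U' ∩ H).card : ℤ) + (({v, π v} ∩ H).card : ℤ))) * hr

/-! ### §2 The first moment of the number of `HH` edges inside the cut -/

omit hπ in
/-- For a representative `v` of an `HH` edge, `|e_v ∩ H| = 2`. [cite: Rothvoss2017, §2 (PDF p. 5)] -/
theorem card_pair_inter_eq_two_of_mem_reps_vAA {S H : Finset (Fin n)} {v : Fin n} (hv : v ∈ reps π (vAA π S H)) :
    (({v, π v} ∩ H : Finset (Fin n)).card : ℤ) = 2 := by
  obtain ⟨hvA, _⟩ := mem_reps.1 hv
  obtain ⟨_, hvH, hπvH⟩ := mem_vAA.1 hvA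
  have : ({v, π v} ∩ H : Finset (Fin n)) = {v, π v} := by
    refine inter_eq_left.2 fun u hu => ?_
    rcases mem_insert.1 hu with rfl | hu
    · exact hvH
    · rw [mem_singleton] at hu; subst hu; exact hπvH
  rw [this, card_pair (hπ' v).symm]; rfl

/-- `n_A(U)` as a sum of indicators: `#{v ∈ reps(vAA) : v, πv ∈ U} = Σ_{v ∈ reps(vAA)} [v ∈ U ∧ πv ∈ U]` (in `ℝ`).
[cite: GodsilMeagher2015, §15.2] -/
theorem hhCount_eq_sum_ite (S H U : Finset (Fin n)) :
    ((((reps π (vAA π S H)).filter fun v => v ∈ U ∧ π v ∈ U).card : ℕ) : ℝ) =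
      ∑ v ∈ reps π (vAA π S H), if (v ∈ U ∧ π v ∈ U) then (1 : ℝ) else 0 := by
  have _ := hπ; have _ := hπ'
  rw [card_filter]; push_cast
  exact sum_congr rfl fun v _ => by split_ifs <;> simp

/-- **FIRST MOMENT**: `Σ_{U ∈ Shell_S(t+2,c)} ψ(|U∩H|)·n_A(U) = Σ_{v ∈ reps(vAA_π(S,H))} Σ_{U′ ∈ Shell_{S∖e_v}(t,c)} ψ(|U′∩H| + 2)`,
where `n_A(U) = #{v ∈ reps(vAA) : v, πv ∈ U}` is the number of `HH` edges of `S` inside `U`.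
[cite: Rothvoss2017, §2 (PDF p. 6)] [cite: GodsilMeagher2015, §15.2] -/
theorem sum_shell_mul_hhCount_eq {S : Finset (Fin n)} (hS : ∀ u ∈ S, π u ∈ S) (H : Finset (Fin n)) (t c : ℕ)
    (ψ : ℤ → ℝ) :
    ∑ U ∈ shellIn π S (t + 2) c, ψ ((U ∩ H).card : ℤ) *
        ((((reps π (vAA π S H)).filter fun v => v ∈ U ∧ π v ∈ U).card : ℕ) : ℝ) =
      ∑ v ∈ reps π (vAA π S H), ∑ U' ∈ shellIn π (S \ {v, π v}) t c, ψ (((U' ∩ H).card : ℤ) + 2) := by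
  have hvS : ∀ v ∈ reps π (vAA π S H), v ∈ S := fun v hv => (mem_vAA.1 (mem_reps.1 hv).1).1
  calc ∑ U ∈ shellIn π S (t + 2) c, ψ ((U ∩ H).card : ℤ) *
          ((((reps π (vAA π S H)).filter fun v => v ∈ U ∧ π v ∈ U).card : ℕ) : ℝ)
      = ∑ U ∈ shellIn π S (t + 2) c, ∑ v ∈ reps π (vAA π S H),
          (if (v ∈ U ∧ π v ∈ U) then ψ ((U ∩ H).card : ℤ) else 0) := by
        refine sum_congr rfl fun U _ => ?_
        rw [hhCount_eq_sum_ite hπ hπ' S H U, mul_sum]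
        exact sum_congr rfl fun v _ => by split_ifs <;> simp
    _ = ∑ v ∈ reps π (vAA π S H), ∑ U ∈ shellIn π S (t + 2) c,
          (if (v ∈ U ∧ π v ∈ U) then ψ ((U ∩ H).card : ℤ) else 0) := sum_comm
    _ = ∑ v ∈ reps π (vAA π S H), ∑ U ∈ (shellIn π S (t + 2) c).filter (fun U => v ∈ U ∧ π v ∈ U),
          ψ ((U ∩ H).card : ℤ) := by
        refine sum_congr rfl fun v _ => ?_
        rw [sum_filter]
    _ = _ := by
        refine sum_congr rfl fun v hv => ?_
        rw [sum_shell_pin_one_eq hπ hπ' hS H (hvS v hv) t c ψ]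
        refine sum_congr rfl fun U' _ => ?_
        rw [card_pair_inter_eq_two_of_mem_reps_vAA hπ' hv]

/-! ### §3 The second factorial moment -/

/-- `n_A(U)·(n_A(U) − 1)` counts ordered pairs of DISTINCT `HH` edges inside `U`:
`#F·(#F − 1) = Σ_{v ∈ R} Σ_{w ∈ R, w ≠ v} [v,πv ∈ U][w,πw ∈ U]` with `F = {v ∈ R : v, πv ∈ U}`, `R = reps(vAA)`.
[cite: GodsilMeagher2015, §15.2] -/
theorem hhCount_mul_pred_eq_sum (S H U : Finset (Fin n)) :
    ((((reps π (vAA π S H)).filter fun v => v ∈ U ∧ π v ∈ U).card : ℕ) : ℝ) *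
        (((((reps π (vAA π S H)).filter fun v => v ∈ U ∧ π v ∈ U).card : ℕ) : ℝ) - 1) =
      ∑ v ∈ reps π (vAA π S H), ∑ w ∈ (reps π (vAA π S H)).erase v,
        if (v ∈ U ∧ π v ∈ U) ∧ (w ∈ U ∧ π w ∈ U) then (1 : ℝ) else 0 := by
  have _ := hπ; have _ := hπ'
  -- inner sum: for `v` inside, it counts the other `HH` edges inside; for `v` outside it vanishes
  have h1 : ∀ v ∈ reps π (vAA π S H),
      ∑ w ∈ (reps π (vAA π S H)).erase v, (if (v ∈ U ∧ π v ∈ U) ∧ (w ∈ U ∧ π w ∈ U) then (1 : ℝ) else 0) =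
      if (v ∈ U ∧ π v ∈ U) then
        (((((reps π (vAA π S H)).filter fun w => w ∈ U ∧ π w ∈ U).erase v).card : ℕ) : ℝ) else 0 := by
    intro v hv
    by_cases hvU : v ∈ U ∧ π v ∈ U
    · rw [if_pos hvU, ← filter_erase, ← sum_boole]
      exact sum_congr rfl fun w _ => by simp only [hvU, true_and]
    · rw [if_neg hvU]
      exact sum_eq_zero fun w _ => by rw [if_neg (fun h => hvU h.1)]
  rw [sum_congr rfl h1, ← sum_filter]
  have h2 : ∀ v ∈ (reps π (vAA π S H)).filter (fun w => w ∈ U ∧ π w ∈ U),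
      (((((reps π (vAA π S H)).filter fun w => w ∈ U ∧ π w ∈ U).erase v).card : ℕ) : ℝ) =
      ((((reps π (vAA π S H)).filter fun w => w ∈ U ∧ π w ∈ U).card : ℕ) : ℝ) - 1 := by
    intro v hv
    rw [card_erase_of_mem hv]
    have : 1 ≤ ((reps π (vAA π S H)).filter fun w => w ∈ U ∧ π w ∈ U).card := card_pos.2 ⟨v, hv⟩
    rw [Nat.cast_sub this]; simp
  rw [sum_congr rfl h2, sum_const, nsmul_eq_mul]

/-- **SECOND FACTORIAL MOMENT**:
`Σ_{U ∈ Shell_S(t+4,c)} ψ(|U∩H|)·n_A(U)(n_A(U)−1) = Σ_{v ∈ reps(vAA)} Σ_{w ∈ reps(vAA), w ≠ v} Σ_{U″ ∈ Shell_{S∖e_v∖e_w}(t,c)} ψ(|U″∩H| + 4)`.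
[cite: Rothvoss2017, §2 (PDF p. 6)] [cite: GodsilMeagher2015, §15.2] -/
theorem sum_shell_mul_hhCount_mul_pred_eq {S : Finset (Fin n)} (hS : ∀ u ∈ S, π u ∈ S) (H : Finset (Fin n))
    (t c : ℕ) (ψ : ℤ → ℝ) :
    ∑ U ∈ shellIn π S (t + 4) c, ψ ((U ∩ H).card : ℤ) *
        (((((reps π (vAA π S H)).filter fun v => v ∈ U ∧ π v ∈ U).card : ℕ) : ℝ) *
          (((((reps π (vAA π S H)).filter fun v => v ∈ U ∧ π v ∈ U).card : ℕ) : ℝ) - 1)) =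
      ∑ v ∈ reps π (vAA π S H), ∑ w ∈ (reps π (vAA π S H)).erase v,
        ∑ U'' ∈ shellIn π (del2 π S v w) t c, ψ (((U'' ∩ H).card : ℤ) + 4) := by
  have hvS : ∀ v ∈ reps π (vAA π S H), v ∈ S := fun v hv => (mem_vAA.1 (mem_reps.1 hv).1).1
  -- representatives of different edges are on different edges
  have hdiff : ∀ v ∈ reps π (vAA π S H), ∀ w ∈ (reps π (vAA π S H)).erase v, w ≠ v ∧ w ≠ π v := by
    intro v hv w hw
    obtain ⟨hwv, hw'⟩ := mem_erase.1 hw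
    refine ⟨hwv, fun h => ?_⟩
    have h1 := (mem_reps.1 hv).2
    have h2 := (mem_reps.1 hw').2
    rw [h, hπ] at h2
    exact lt_asymm h1 h2
  calc ∑ U ∈ shellIn π S (t + 4) c, ψ ((U ∩ H).card : ℤ) *
          (((((reps π (vAA π S H)).filter fun v => v ∈ U ∧ π v ∈ U).card : ℕ) : ℝ) *
            (((((reps π (vAA π S H)).filter fun v => v ∈ U ∧ π v ∈ U).card : ℕ) : ℝ) - 1))
      = ∑ U ∈ shellIn π S (t + 4) c, ∑ v ∈ reps π (vAA π S H), ∑ w ∈ (reps π (vAA π S H)).erase v,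
          (if (v ∈ U ∧ π v ∈ U) ∧ (w ∈ U ∧ π w ∈ U) then ψ ((U ∩ H).card : ℤ) else 0) := by
        refine sum_congr rfl fun U _ => ?_
        rw [hhCount_mul_pred_eq_sum hπ hπ' S H U, mul_sum]
        refine sum_congr rfl fun v _ => ?_
        rw [mul_sum]
        exact sum_congr rfl fun w _ => by split_ifs <;> simp
    _ = ∑ v ∈ reps π (vAA π S H), ∑ U ∈ shellIn π S (t + 4) c, ∑ w ∈ (reps π (vAA π S H)).erase v,
          (if (v ∈ U ∧ π v ∈ U) ∧ (w ∈ U ∧ π w ∈ U) then ψ ((U ∩ H).card : ℤ) else 0) := sum_comm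
    _ = ∑ v ∈ reps π (vAA π S H), ∑ w ∈ (reps π (vAA π S H)).erase v, ∑ U ∈ shellIn π S (t + 4) c,
          (if (v ∈ U ∧ π v ∈ U) ∧ (w ∈ U ∧ π w ∈ U) then ψ ((U ∩ H).card : ℤ) else 0) := by
        refine sum_congr rfl fun v _ => ?_
        exact sum_comm
    _ = ∑ v ∈ reps π (vAA π S H), ∑ w ∈ (reps π (vAA π S H)).erase v,
          ∑ U ∈ (shellIn π S (t + 4) c).filter (fun U => v ∈ U ∧ π v ∈ U ∧ w ∈ U ∧ π w ∈ U),
            ψ ((U ∩ H).card : ℤ) := by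
        refine sum_congr rfl fun v _ => sum_congr rfl fun w _ => ?_
        rw [sum_filter]
        exact sum_congr rfl fun U _ => by
          by_cases h : v ∈ U ∧ π v ∈ U ∧ w ∈ U ∧ π w ∈ U
          · rw [if_pos h, if_pos ⟨⟨h.1, h.2.1⟩, h.2.2⟩]
          · rw [if_neg h, if_neg (fun h' => h ⟨h'.1.1, h'.1.2, h'.2.1, h'.2.2⟩)]
    _ = _ := by
        refine sum_congr rfl fun v hv => sum_congr rfl fun w hw => ?_
        obtain ⟨hwv, hwπ⟩ := hdiff v hv w hw
        have hw' := (mem_erase.1 hw).2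
        rw [sum_shell_pin_two_eq hπ hπ' hS H (hvS v hv) (hvS w hw') hwv hwπ t c ψ]
        refine sum_congr rfl fun U'' _ => ?_
        rw [card_pair_inter_eq_two_of_mem_reps_vAA hπ' hv, card_pair_inter_eq_two_of_mem_reps_vAA hπ' hw',
          show ((U'' ∩ H).card : ℤ) + 2 + 2 = ((U'' ∩ H).card : ℤ) + 4 by ring]

/-! ### §4 (v2 append) The averaged forms: the pinning probabilities `s/N` and `s(s−1)/(N(N−1))` -/

/-- Dividing a pinned sum by the shell size: `(Σ_{U′ ∈ Shell_{S∖e_v}(t,c)} g)/|Shell_S(t+2,c)| =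
((t+2−c)/|S|)·(Σ_{U′} g)/|Shell_{S∖e_v}(t,c)|` (`card_shellIn_sdiff_pair_ratio`). [cite: Rothvoss2017, §2 (PDF p. 6)] -/
theorem div_card_shell_eq_ratio_mul_div {S : Finset (Fin n)} (hS : ∀ u ∈ S, π u ∈ S) {v : Fin n} (hv : v ∈ S)
    (t c : ℕ) (hne : (shellIn π S (t + 2) c).Nonempty) (Z : ℝ) (hZ : shellIn π (S \ {v, π v}) t c = ∅ → Z = 0) :
    Z / ((shellIn π S (t + 2) c).card : ℝ) =
      (((t : ℝ) + 2 - c) / (S.card : ℝ)) * (Z / ((shellIn π (S \ {v, π v}) t c).card : ℝ)) := by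
  have hr := card_shellIn_sdiff_pair_ratio hπ hπ' hS hv t c
  have hS2 : t + 2 + c ≤ S.card := by obtain ⟨U, hU⟩ := hne; exact add_le_of_mem_shellIn hπ hS hU
  have hSpos : (0 : ℝ) < S.card := by
    have : (2 : ℝ) ≤ S.card := by exact_mod_cast (show 2 ≤ S.card by omega)
    linarith
  have hA : (0 : ℝ) < (shellIn π S (t + 2) c).card := by exact_mod_cast hne.card_pos
  by_cases hB : shellIn π (S \ {v, π v}) t c = ∅
  · simp [hZ hB]
  have hBpos : (0 : ℝ) < (shellIn π (S \ {v, π v}) t c).card := by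
    exact_mod_cast (nonempty_iff_ne_empty.2 hB).card_pos
  rw [div_mul_div_comm, div_eq_div_iff hA.ne' (mul_ne_zero hSpos.ne' hBpos.ne')]
  linear_combination Z * hr

/-- **FIRST MOMENT, averaged**: for `Shell_S(t+2,c) ≠ ∅`,
`E_{Shell_S(t+2,c)}[ψ(|U∩H|)·n_A(U)] = ((t+2−c)/|S|)·Σ_{v ∈ reps(vAA)} E_{Shell_{S∖e_v}(t,c)}[ψ(|U′∩H| + 2)]` — the probability
that a given `HH` edge is full is `s/N` (`s = (t+2−c)/2`, `N = |S|/2`), LINEAR in the level. [cite: Rothvoss2017, §2 (PDF p. 6)] -/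
theorem shellAvg_mul_hhCount_eq {S : Finset (Fin n)} (hS : ∀ u ∈ S, π u ∈ S) (H : Finset (Fin n)) (t c : ℕ)
    (ψ : ℤ → ℝ) (hne : (shellIn π S (t + 2) c).Nonempty) :
    (∑ U ∈ shellIn π S (t + 2) c, ψ ((U ∩ H).card : ℤ) *
        ((((reps π (vAA π S H)).filter fun v => v ∈ U ∧ π v ∈ U).card : ℕ) : ℝ)) /
        ((shellIn π S (t + 2) c).card : ℝ) =
      (((t : ℝ) + 2 - c) / (S.card : ℝ)) * ∑ v ∈ reps π (vAA π S H),
        (∑ U' ∈ shellIn π (S \ {v, π v}) t c, ψ (((U' ∩ H).card : ℤ) + 2)) /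
          ((shellIn π (S \ {v, π v}) t c).card : ℝ) := by
  rw [sum_shell_mul_hhCount_eq hπ hπ' hS H t c ψ, sum_div, mul_sum]
  refine sum_congr rfl fun v hv => ?_
  have hvS : v ∈ S := (mem_vAA.1 (mem_reps.1 hv).1).1
  exact div_card_shell_eq_ratio_mul_div hπ hπ' hS hvS t c hne _ (fun h => by rw [h, sum_empty])

/-- **SECOND FACTORIAL MOMENT, averaged**: for `Shell_S(t+4,c) ≠ ∅`,
`E_{Shell_S(t+4,c)}[ψ(|U∩H|)·n_A(U)(n_A(U)−1)] = ((t+4−c)(t+2−c)/(|S|(|S|−2)))·Σ_{v ≠ w ∈ reps(vAA)} E_{Shell_{S∖e_v∖e_w}(t,c)}[ψ(|U″∩H| + 4)]`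
— the probability that two given edges are full is `s(s−1)/(N(N−1))`, QUADRATIC in the level. [cite: Rothvoss2017, §2 (PDF p. 6)] -/
theorem shellAvg_mul_hhCount_mul_pred_eq {S : Finset (Fin n)} (hS : ∀ u ∈ S, π u ∈ S) (H : Finset (Fin n))
    (t c : ℕ) (ψ : ℤ → ℝ) (hne : (shellIn π S (t + 4) c).Nonempty) :
    (∑ U ∈ shellIn π S (t + 4) c, ψ ((U ∩ H).card : ℤ) *
        (((((reps π (vAA π S H)).filter fun v => v ∈ U ∧ π v ∈ U).card : ℕ) : ℝ) *
          (((((reps π (vAA π S H)).filter fun v => v ∈ U ∧ π v ∈ U).card : ℕ) : ℝ) - 1))) /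
        ((shellIn π S (t + 4) c).card : ℝ) =
      (((t : ℝ) + 4 - c) * ((t : ℝ) + 2 - c) / ((S.card : ℝ) * ((S.card : ℝ) - 2))) *
        ∑ v ∈ reps π (vAA π S H), ∑ w ∈ (reps π (vAA π S H)).erase v,
          (∑ U'' ∈ shellIn π (del2 π S v w) t c, ψ (((U'' ∩ H).card : ℤ) + 4)) /
            ((shellIn π (del2 π S v w) t c).card : ℝ) := by
  rw [sum_shell_mul_hhCount_mul_pred_eq hπ hπ' hS H t c ψ, sum_div, mul_sum]
  refine sum_congr rfl fun v hv => ?_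
  rw [sum_div, mul_sum]
  refine sum_congr rfl fun w hw => ?_
  have hvS : v ∈ S := (mem_vAA.1 (mem_reps.1 hv).1).1
  obtain ⟨hwv, hw'⟩ := mem_erase.1 hw
  have hwS : w ∈ S := (mem_vAA.1 (mem_reps.1 hw').1).1
  have hwπ : w ≠ π v := fun h => by
    have h1 := (mem_reps.1 hv).2
    have h2 := (mem_reps.1 hw').2
    rw [h, hπ] at h2
    exact lt_asymm h1 h2
  have hr := card_shellIn_del2_full_ratio hπ hπ' hS hvS hwS hwv hwπ t c
  have hS6 : t + 4 + c ≤ S.card := by obtain ⟨U, hU⟩ := hne; exact add_le_of_mem_shellIn hπ hS hU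
  have h4 : (4 : ℝ) ≤ S.card := by exact_mod_cast (show 4 ≤ S.card by omega)
  have hden : 0 < (S.card : ℝ) * ((S.card : ℝ) - 2) := mul_pos (by linarith) (by linarith)
  have hA : (0 : ℝ) < (shellIn π S (t + 4) c).card := by exact_mod_cast hne.card_pos
  by_cases hB : shellIn π (del2 π S v w) t c = ∅
  · simp [hB]
  have hBpos : (0 : ℝ) < (shellIn π (del2 π S v w) t c).card := by
    exact_mod_cast (nonempty_iff_ne_empty.2 hB).card_pos
  rw [div_mul_div_comm, div_eq_div_iff hA.ne' (mul_ne_zero hden.ne' hBpos.ne')]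
  linear_combination (∑ U'' ∈ shellIn π (del2 π S v w) t c, ψ (((U'' ∩ H).card : ℤ) + 4)) * hr

end Pin

end ShellStep

end Literature.Combinatorics.Optimization

end
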